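import Summits.Parity.BatemanHorn.Theses.RoughValueTransport
import Literature.NumberTheory.Sieve.BuchstabLimitFact
import HarnessLib

/-!
# Route `RoughValueTransport`, crux `RoughValueLaw` (stmt-Parity-11390), line
# `increment-anchoring`: the registered stub `stub_omegaFacts`

`--supports` file of the checked skeleton
`Summits/Parity/BatemanHorn/Cruxes/RoughValueLaw/Lines/increment-anchoring.lean`
(crux `Summit.Parity.BatemanHorn.Theses.RoughValueTransport.RoughValueLaw`).  It PROVES the
registered stub, verbatim:
`stub_omegaFacts : ∀ ω : ℝ → ℝ, ((∀ u, 1 ≤ u → u ≤ 2 → ω u = u⁻¹) ∧ ContinuousOn ω (Ici 1) ∧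
(∀ u, 2 < u → HasDerivAt (fun t => t * ω t) (ω (u - 1)) u)) →
(∀ u, 2 ≤ u → u ≤ 3 → u * ω u = 1 + log (u - 1)) ∧ Tendsto ω atTop (𝓝 e^{−γ})` —
what the crux's INLINE Buchstab predicate (`ω = 1/u` on `[1,2]`, continuity on `[1,∞)`,
`(uω(u))' = ω(u−1)` for `u > 2`) pins down: (a) `uω(u) = 1 + log(u−1)` on `[2,3]` and
(b) `ω(u) → e^{−γ}`.  Everything used is PROVED in the tree; no definition and no new fact is
introduced.

## The argument (sub-namespace `OmegaFacts`)

1. (`eq_buchstabOmega_of_le`, `eq_buchstabOmega`) **Uniqueness by the method of steps.**  The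
   predicate has exactly ONE solution on `[1,∞)`, the tree's Buchstab function
   `Literature.NumberTheory.Sieve.buchstabOmega` (`BuchstabFunction.lean`), which satisfies it by
   `buchstabOmega_eq_inv`, `continuousOn_buchstabOmega`, `hasDerivAt_mul_buchstabOmega`.  Put
   `h(t) = tω(t) − t·buchstabOmega(t)`; `h = 0` on `[1,2]`; if `ω = buchstabOmega` on `[1, n+2]`
   then for `t ∈ (n+2, n+3]` the function `h` is continuous on `[n+2, t] ⊂ [1,∞)` and has
   derivative `ω(s−1) − buchstabOmega(s−1) = 0` at every `s ∈ (n+2, t)` (as `s − 1 ∈ [1, n+2]`),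
   so Lagrange's MVT (`exists_hasDerivAt_eq_slope`) gives `h(t) = h(n+2) = 0`, i.e.
   `ω(t) = buchstabOmega(t)` (`t > 0`).  Induction on `n : ℕ`.
2. Clause (a) is then `buchstabOmega_eq_of_mem_Icc_two_three` (`ω(u) = (1 + log(u−1))/u` on
   `[2,3]`), clause (b) the PROVED de Bruijn limit `harman2007_buchstabOmega_tendsto_holds`
   (`BuchstabLimitFact.lean`) transported along the eventual equality `ω = buchstabOmega` on
   `[1,∞)` (`Filter.Tendsto.congr'`).

References: G. Harman, *Prime-Detecting Sieves* (2007), §1.4 and Appendix A.2;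
N. G. de Bruijn, Indag. Math. 12 (1950) 247–256; the line card
`Cruxes/RoughValueLaw/Lines/increment-anchoring.md`.
-/

noncomputable section

open Filter Finset Polynomial
open Literature.NumberTheory.Sieve
open scoped Topology BigOperators

namespace Summit.Parity.BatemanHorn.Cruxes.RoughValueLaw.IncrementAnchoring

namespace OmegaFacts

/-- **Uniqueness of Buchstab's function, inductive form (method of steps).**  If `ω = 1/u` on
`[1,2]`, `ω` is continuous on `[1,∞)` and `(uω(u))' = ω(u−1)` for `u > 2`, then
`ω = buchstabOmega` on `[1, n+2]` for every `n : ℕ`: on `[1,2]` both are `1/u`; on the next unit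
interval the difference `t(ω(t) − buchstabOmega(t))` is continuous with zero derivative inside
(its derivative at `s` is `ω(s−1) − buchstabOmega(s−1)`), hence constant `= 0` by Lagrange's mean
value theorem. [folklore] -/
theorem eq_buchstabOmega_of_le {ω : ℝ → ℝ} (hinit : ∀ u : ℝ, 1 ≤ u → u ≤ 2 → ω u = u⁻¹)
    (hcont : ContinuousOn ω (Set.Ici 1))
    (hdde : ∀ u : ℝ, 2 < u → HasDerivAt (fun t : ℝ => t * ω t) (ω (u - 1)) u) :
    ∀ n : ℕ, ∀ t : ℝ, 1 ≤ t → t ≤ n + 2 → ω t = buchstabOmega t := by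
  intro n
  induction n with
  | zero =>
    intro t h1 h2
    have h2' : t ≤ 2 := by simpa using h2
    rw [hinit t h1 h2', buchstabOmega_eq_inv h1 h2']
  | succ n ih =>
    intro t h1 h2
    push_cast at h2
    rcases le_or_gt t (n + 2) with ht | ht
    · exact ih t h1 ht
    -- `t ∈ (a, a + 1]` with `a = n + 2 ≥ 2`
    set a : ℝ := (n : ℝ) + 2 with ha
    have hn0 : (0 : ℝ) ≤ n := n.cast_nonneg
    have ha2 : (2 : ℝ) ≤ a := by rw [ha]; linarith
    have hat : a < t := ht
    -- the difference `h s := s ω s − s buchstabOmega s` on `[a, t]`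
    have hcont' : ContinuousOn (fun s : ℝ => s * ω s - s * buchstabOmega s) (Set.Icc a t) := by
      have hsub : Set.Icc a t ⊆ Set.Ici 1 := fun s hs =>
        show (1 : ℝ) ≤ s from le_trans (by linarith) hs.1
      exact ((continuousOn_id.mul hcont).sub continuousOn_mul_buchstabOmega).mono hsub
    have hderiv : ∀ s ∈ Set.Ioo a t, HasDerivAt (fun s : ℝ => s * ω s - s * buchstabOmega s)
        ((fun s : ℝ => ω (s - 1) - buchstabOmega (s - 1)) s) s := by
      intro s hs
      have hs2 : 2 < s := lt_of_le_of_lt ha2 hs.1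
      exact (hdde s hs2).sub (hasDerivAt_mul_buchstabOmega hs2)
    obtain ⟨c, hc, hc'⟩ := exists_hasDerivAt_eq_slope
      (fun s : ℝ => s * ω s - s * buchstabOmega s)
      (fun s : ℝ => ω (s - 1) - buchstabOmega (s - 1)) hat hcont' hderiv
    have hc1 : 1 ≤ c - 1 := by linarith [hc.1]
    have hc2 : c - 1 ≤ n + 2 := by linarith [hc.2]
    have hzero : ω (c - 1) - buchstabOmega (c - 1) = 0 := by
      rw [ih (c - 1) hc1 hc2, sub_self]
    rw [hzero, eq_comm, div_eq_zero_iff] at hc'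
    have hne : t - a ≠ 0 := sub_ne_zero.mpr (ne_of_gt hat)
    have hdiff : t * ω t - t * buchstabOmega t - (a * ω a - a * buchstabOmega a) = 0 :=
      hc'.resolve_right hne
    have haa : ω a = buchstabOmega a := ih a (by linarith) le_rfl
    rw [haa, sub_self, sub_zero, sub_eq_zero] at hdiff
    have ht0 : (0 : ℝ) < t := by linarith
    exact mul_left_cancel₀ ht0.ne' hdiff

/-- **Uniqueness of Buchstab's function.**  Any `ω` with `ω = 1/u` on `[1,2]`, continuous on
`[1,∞)` and with `(uω(u))' = ω(u−1)` for `u > 2` coincides with the tree's `buchstabOmega` on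
`[1,∞)` (method of steps, `eq_buchstabOmega_of_le`). [folklore] -/
theorem eq_buchstabOmega {ω : ℝ → ℝ} (hinit : ∀ u : ℝ, 1 ≤ u → u ≤ 2 → ω u = u⁻¹)
    (hcont : ContinuousOn ω (Set.Ici 1))
    (hdde : ∀ u : ℝ, 2 < u → HasDerivAt (fun t : ℝ => t * ω t) (ω (u - 1)) u) {t : ℝ}
    (ht : 1 ≤ t) : ω t = buchstabOmega t := by
  obtain ⟨n, hn⟩ := exists_nat_ge (t - 2)
  exact eq_buchstabOmega_of_le hinit hcont hdde n t ht (by linarith)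

end OmegaFacts

/-- **stub_omegaFacts** (registered stub of the skeleton
`Cruxes/RoughValueLaw/Lines/increment-anchoring.lean`, crux stmt-Parity-11390).
Any `ω` with `ω(u) = 1/u` on `[1,2]`, continuous on `[1,∞)` and `(uω(u))' = ω(u−1)` for `u > 2`
satisfies (a) `uω(u) = 1 + log(u−1)` on `[2,3]` and (b) `ω(u) → e^{−γ}` as `u → ∞`: such an `ω`
IS Buchstab's function on `[1,∞)` (`OmegaFacts.eq_buchstabOmega`), for which (a) is
`buchstabOmega_eq_of_mem_Icc_two_three` and (b) is the PROVED de Bruijn limit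
`harman2007_buchstabOmega_tendsto_holds`. [folklore] -/
theorem stub_omegaFacts :
    ∀ ω : ℝ → ℝ, ((∀ u : ℝ, 1 ≤ u → u ≤ 2 → ω u = u⁻¹) ∧ ContinuousOn ω (Set.Ici 1) ∧
        (∀ u : ℝ, 2 < u → HasDerivAt (fun t : ℝ => t * ω t) (ω (u - 1)) u)) →
      (∀ u : ℝ, 2 ≤ u → u ≤ 3 → u * ω u = 1 + Real.log (u - 1)) ∧
      Tendsto ω atTop (𝓝 (Real.exp (-Real.eulerMascheroniConstant))) := by
  rintro ω ⟨hinit, hcont, hdde⟩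
  have heq : ∀ t : ℝ, 1 ≤ t → ω t = buchstabOmega t := fun t ht =>
    OmegaFacts.eq_buchstabOmega hinit hcont hdde ht
  refine ⟨fun u h2 h3 => ?_, ?_⟩
  · rw [heq u (by linarith), buchstabOmega_eq_of_mem_Icc_two_three h2 h3,
      mul_div_cancel₀ _ (by linarith : u ≠ 0)]
  · have hlim : Tendsto buchstabOmega atTop (𝓝 (Real.exp (-Real.eulerMascheroniConstant))) :=
      harman2007_buchstabOmega_tendsto_holds
    refine hlim.congr' ?_
    filter_upwards [eventually_ge_atTop (1 : ℝ)] with u hu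
    exact (heq u hu).symm

end Summit.Parity.BatemanHorn.Cruxes.RoughValueLaw.IncrementAnchoring

end
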